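import Summits.CriticalPhenomena.Ising3DConformalLimit.Theses.GaussianScaleMixture
import Summits.CriticalPhenomena.Ising3DConformalLimit.Theorems.RotationUpgradeFromTwoPoint.Negative.CubicDecoyNegatives
import Summits.CriticalPhenomena.Ising3DConformalLimit.Theorems.RotationUpgradeFromTwoPoint.Negative.CoincidentDecoration
import Summits.CriticalPhenomena.Ising3DConformalLimit.Theorems.MoebiusLimitExists.Negative.ScaleRedundant
import Literature.Probability.LatticeModels.ScalingLimit3D

/-!
# `RotationUpgradeFromTwoPoint` (item stmt-CriticalPhenomena-8367): load-bearing hypotheses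

Negative knowledge about the crux
`Summit.CriticalPhenomena.Ising3DConformalLimit.Theses.GaussianScaleMixture.RotationUpgradeFromTwoPoint`
(standing crux disprover, D-0016, cycle 1; THEOREM-ONLY). Hypotheses on `(ρ, Δ, S)`: (H1) `ρ > 0` on
`(0,1]`; (H2) `HasPointwiseScalingLimit (criticalCorr 3) ρ S`; (H3) `S = 0` off `NonCoincident`;
(H4) `IsNondegenerateTwoPoint S`; (H5) `IsTranslationInvariant S`; (H6) `IsScaleCovariant Δ S`;
(H7) two-point isotropy `∀ R x, x ≠ 0 → S 2 ![0, R x] = S 2 ![0, x]`; conclusion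
`IsRotationInvariant S`.

* **(H2) is load-bearing at every `Δ ≠ 0`** (`not_cruxWithoutIsingLimit`): the cubic decoy
  `cubicFamily Δ` of `Negative/CubicDecoy*.lean` has (H3)–(H7) and is not rotation invariant —
  two-point isotropy, translations, dilations, normalisation and non-degeneracy do not touch `S₄`.
* **(H2) cannot be weakened to lattice provenance** (`not_cruxWithLatticeLimit`, `Δ ≠ 0`) **nor to
  lattice provenance decorated with every generic lattice structure formalised in the tree**
  (`not_cruxWithCubicLatticeLimit`, `Δ > 0`: `B₃` invariance, permutation symmetry, positivity,
  Lebowitz sign, Aizenman–Griffiths domination, continuity off diagonals, clustering of `U₄`): the decoy is the scaling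
  limit of its own sampling on `ℤ³` and has all of them. A proof must use a property of
  `criticalCorr 3` that the decoy LACKS: reflection positivity of ALL orders (the decoy is not RP,
  `cubicFamily_not_reflectionPositive`), the random-current representation of `U₄`, lattice
  switching/Ward identities.
* **(H3) is load-bearing** granted that the intended object exists at all
  (`not_cruxWithoutNormalisation`, from `CritIsing3DEuclideanLimit`: decorate `S₃` on the coincident
  locus, `Negative/CoincidentDecoration.lean`), while WITH (H3) the Euclidean limit normalises to an
  instance of all seven hypotheses that is rotation invariant (`exists_hyp_of_euclideanLimit`: the
  hypotheses are satisfiable and consistent with the conclusion as soon as the limit exists).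
* (H5), (H6), `Δ` are redundant (`Negative/AutomaticOrders.lean`, `crux_iff_core`) and so is (H4)
  (`Negative/NondegeneracyRedundant.lean`, `crux_iff_withoutNondegeneracy`); the continuity clause of
  `not_cruxWithCubicLatticeLimit` is met by every instance of the crux (`Negative/ContinuityFree.lean`,
  `limit_continuousOn`); (H1), (H7) cannot be dropped-and-refuted without the Ising limit itself.
-/

noncomputable section

namespace Summit.CriticalPhenomena.Ising3DConformalLimit.RotationUpgradeFromTwoPointNegative

open Literature.Probability.LatticeModels Literature.Barriers.CriticalPhenomena
open Literature.MathematicalPhysics.QuantumFieldTheory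
open Filter Set Function ScaleNotMoebius
open Summit.CriticalPhenomena.Ising3DConformalLimit.MoebiusLimitExistsNegative
open scoped Topology

/-! ## (H2): the Ising lattice clause -/

/-- **(H2) is load-bearing at EVERY `Δ ≠ 0`** (in particular on the whole window `[1/2, 1]` and at
the bootstrap value `Δ_σ ≈ 0.518`): the crux with (H1)+(H2) deleted is false, witness
`cubicFamily Δ`. [folklore] -/
theorem not_cruxWithoutIsingLimit {Δ : ℝ} (hΔ : Δ ≠ 0) :
    ¬ ∀ S : CorrFamily 3, (∀ n z, z ∉ NonCoincident 3 n → S n z = 0) → IsNondegenerateTwoPoint S →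
      IsTranslationInvariant S → IsScaleCovariant Δ S →
      (∀ (R : EuclideanSpace ℝ (Fin 3) ≃ₗᵢ[ℝ] EuclideanSpace ℝ (Fin 3)) (x : EuclideanSpace ℝ (Fin 3)),
        x ≠ 0 → S 2 ![0, R x] = S 2 ![0, x]) →
      IsRotationInvariant S := fun h =>
  cubicFamily_not_isRotationInvariant Δ (h _ (cubicFamily_eq_zero_of_not_mem hΔ)
    (cubicFamily_isNondegenerateTwoPoint Δ) (cubicFamily_isTranslationInvariant Δ)
    (cubicFamily_isScaleCovariant Δ) (cubicFamily_twoPointIsotropic Δ))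

/-- **Lattice provenance does not rescue (H2)** (`Δ ≠ 0`): the crux with `criticalCorr 3` weakened
to an ARBITRARY lattice family `G` is false — the decoy is the scaling limit of its own sampling on
`ℤ³` with `ρ δ = δ^{-Δ}`. [folklore] -/
theorem not_cruxWithLatticeLimit {Δ : ℝ} (hΔ : Δ ≠ 0) :
    ¬ ∀ (G : LatticeCorrFamily 3) (ρ : ℝ → ℝ) (S : CorrFamily 3), (∀ δ ∈ Set.Ioc (0:ℝ) 1, 0 < ρ δ) →
      HasPointwiseScalingLimit G ρ S → (∀ n z, z ∉ NonCoincident 3 n → S n z = 0) →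
      IsNondegenerateTwoPoint S → IsTranslationInvariant S → IsScaleCovariant Δ S →
      (∀ (R : EuclideanSpace ℝ (Fin 3) ≃ₗᵢ[ℝ] EuclideanSpace ℝ (Fin 3)) (x : EuclideanSpace ℝ (Fin 3)),
        x ≠ 0 → S 2 ![0, R x] = S 2 ![0, x]) →
      IsRotationInvariant S := by
  intro h
  exact cubicFamily_not_isRotationInvariant Δ (h (cubicLattice Δ) (fun δ => δ ^ (-Δ)) (cubicFamily Δ)
    (fun δ hδ => Real.rpow_pos_of_pos hδ.1 _) (cubicFamily_hasPointwiseScalingLimit Δ)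
    (cubicFamily_eq_zero_of_not_mem hΔ) (cubicFamily_isNondegenerateTwoPoint Δ)
    (cubicFamily_isTranslationInvariant Δ) (cubicFamily_isScaleCovariant Δ)
    (cubicFamily_twoPointIsotropic Δ))

/-- **Lattice provenance plus ALL generic lattice structure formalised in the tree does not rescue
(H2)** (`Δ > 0`): `B₃` invariance (coordinate permutations and sign flips), permutation symmetry,
positivity of all correlations, the Lebowitz sign `U₄ ≤ 0`, the Aizenman–Griffiths domination
`|U₄| ≤ S₂²`, continuity off the diagonals and clustering of `U₄` (OS E4 shape), on top of the hypotheses of `not_cruxWithLatticeLimit`,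
still do not give rotation invariance — the cubic decoy has every one of them. So a proof of the
crux must use a property of `criticalCorr 3` the decoy lacks (it is NOT reflection positive:
`cubicFamily_not_reflectionPositive`). [folklore] -/
theorem not_cruxWithCubicLatticeLimit {Δ : ℝ} (hΔ : 0 < Δ) :
    ¬ ∀ (G : LatticeCorrFamily 3) (ρ : ℝ → ℝ) (S : CorrFamily 3), (∀ δ ∈ Set.Ioc (0:ℝ) 1, 0 < ρ δ) →
      HasPointwiseScalingLimit G ρ S → (∀ n z, z ∉ NonCoincident 3 n → S n z = 0) →
      IsNondegenerateTwoPoint S → IsTranslationInvariant S → IsScaleCovariant Δ S →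
      (∀ (R : EuclideanSpace ℝ (Fin 3) ≃ₗᵢ[ℝ] EuclideanSpace ℝ (Fin 3)) (x : EuclideanSpace ℝ (Fin 3)),
        x ≠ 0 → S 2 ![0, R x] = S 2 ![0, x]) →
      (∀ (π : Equiv.Perm (Fin 3)) (n : ℕ) (x : Fin n → EuclideanSpace ℝ (Fin 3)),
        S n (fun i => LinearIsometryEquiv.piLpCongrLeft 2 ℝ ℝ π (x i)) = S n x) →
      (∀ (ε : Fin 3 → ℤˣ) (R : EuclideanSpace ℝ (Fin 3) ≃ₗᵢ[ℝ] EuclideanSpace ℝ (Fin 3)),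
        (∀ (p : EuclideanSpace ℝ (Fin 3)) (j : Fin 3), R p j = ((ε j : ℤ) : ℝ) * p j) →
        ∀ (n : ℕ) (x : Fin n → EuclideanSpace ℝ (Fin 3)), S n (fun i => R (x i)) = S n x) →
      IsPermutationSymmetric S → (∀ n x, 0 ≤ S n x) → (∀ x, limitConnectedFour S x ≤ 0) →
      (∀ x ∈ NonCoincident 3 4, ∀ i j : Fin 4, i ≠ j → |limitConnectedFour S x| ≤ S 2 ![x i, x j] ^ 2) →
      (∀ n, ContinuousOn (S n) (NonCoincident 3 n)) →
      (∀ x₀ x₁ y₀ y₁ : EuclideanSpace ℝ (Fin 3), x₀ ≠ x₁ → y₀ ≠ y₁ →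
        Tendsto (fun a : EuclideanSpace ℝ (Fin 3) => limitConnectedFour S ![x₀, x₁, y₀ + a, y₁ + a])
          (cocompact (EuclideanSpace ℝ (Fin 3))) (𝓝 0)) →
      IsRotationInvariant S := by
  intro h
  exact cubicFamily_not_isRotationInvariant Δ (h (cubicLattice Δ) (fun δ => δ ^ (-Δ)) (cubicFamily Δ)
    (fun δ hδ => Real.rpow_pos_of_pos hδ.1 _) (cubicFamily_hasPointwiseScalingLimit Δ)
    (cubicFamily_eq_zero_of_not_mem hΔ.ne') (cubicFamily_isNondegenerateTwoPoint Δ)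
    (cubicFamily_isTranslationInvariant Δ) (cubicFamily_isScaleCovariant Δ)
    (cubicFamily_twoPointIsotropic Δ) (cubicFamily_coordPerm Δ) (cubicFamily_signFlip Δ)
    (cubicFamily_isPermutationSymmetric Δ) (cubicFamily_nonneg hΔ.le)
    (limitConnectedFour_cubicFamily_nonpos Δ)
    (fun x hx i j hij => abs_limitConnectedFour_cubicFamily_le hΔ.le hx hij)
    (continuousOn_cubicFamily Δ) (fun x₀ x₁ y₀ y₁ hx hy => cubicFamily_cluster hΔ hx hy))

/-! ## (H3): the normalisation -/

/-- **(H3) is load-bearing**: granted that the intended object exists at all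
(`CritIsing3DEuclideanLimit`), the crux WITHOUT the normalisation is false — decorate `S₃` on the
coincident locus, which (H2) does not see (`Negative/CoincidentDecoration.lean`; same mechanism as
the refutation of item 0637, `IsingEuclidUpgrade.not_inversionUpgrade_of_euclideanLimit`). [folklore] -/
theorem not_cruxWithoutNormalisation (hE : CritIsing3DEuclideanLimit) :
    ¬ ∀ (ρ : ℝ → ℝ) (Δ : ℝ) (S : CorrFamily 3), (∀ δ ∈ Set.Ioc (0:ℝ) 1, 0 < ρ δ) →
      HasPointwiseScalingLimit (criticalCorr 3) ρ S → IsNondegenerateTwoPoint S →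
      IsTranslationInvariant S → IsScaleCovariant Δ S →
      (∀ (R : EuclideanSpace ℝ (Fin 3) ≃ₗᵢ[ℝ] EuclideanSpace ℝ (Fin 3)) (x : EuclideanSpace ℝ (Fin 3)),
        x ≠ 0 → S 2 ![0, R x] = S 2 ![0, x]) →
      IsRotationInvariant S := by
  obtain ⟨ρ, Δ, S, hρ, -, hlim, hnd, heuc, hsc⟩ := hE
  intro h
  exact decorate_not_rot Δ heuc.2 (h ρ Δ (decorate Δ S) hρ (decorate_lim Δ hlim)
    (decorate_nondeg Δ hnd) (decorate_transl Δ heuc.1) (decorate_scale hsc) (decorate_iso Δ heuc.2))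

/-- Conversely, WITH (H3) any Euclidean limit normalises to an instance of ALL seven hypotheses that
IS rotation invariant: `CritIsing3DEuclideanLimit` makes the hypotheses of the crux satisfiable
(no vacuity) and is consistent with its conclusion. [folklore] -/
theorem exists_hyp_of_euclideanLimit (hE : CritIsing3DEuclideanLimit) :
    ∃ (ρ : ℝ → ℝ) (Δ : ℝ) (S : CorrFamily 3), (∀ δ ∈ Set.Ioc (0:ℝ) 1, 0 < ρ δ) ∧
      HasPointwiseScalingLimit (criticalCorr 3) ρ S ∧ (∀ n z, z ∉ NonCoincident 3 n → S n z = 0) ∧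
      IsNondegenerateTwoPoint S ∧ IsTranslationInvariant S ∧ IsScaleCovariant Δ S ∧
      (∀ (R : EuclideanSpace ℝ (Fin 3) ≃ₗᵢ[ℝ] EuclideanSpace ℝ (Fin 3)) (x : EuclideanSpace ℝ (Fin 3)),
        x ≠ 0 → S 2 ![0, R x] = S 2 ![0, x]) ∧
      IsRotationInvariant S := by
  classical
  obtain ⟨ρ, Δ, S, hρ, -, hlim, hnd, heuc, hsc⟩ := hE
  refine ⟨ρ, Δ, fun n x => if x ∈ NonCoincident 3 n then S n x else 0, hρ, normalised_hasLimit hlim,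
    fun n z hz => if_neg hz, normalised_nondeg hnd, normalised_translation heuc.1,
    normalised_scale hsc, ?_, normalised_rotation heuc.2⟩
  intro R x _
  have h := normalised_rotation heuc.2 2 R ![0, x]
  have hcfg : (fun i => R ((![0, x] : Fin 2 → EuclideanSpace ℝ (Fin 3)) i)) = ![0, R x] := by
    funext i; fin_cases i <;> simp
  rw [hcfg] at h
  exact h

end Summit.CriticalPhenomena.Ising3DConformalLimit.RotationUpgradeFromTwoPointNegative

end
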